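/-
Copyright (c) 2026 the pub-hodgecm-mathlib formalisation cell (harness21).  Prover seat hodgecm-mathlib-R90-IF-p04 (g2), programme R90-TF, section S9 «InnerForm-13.3.6 (c)»,
deal (e3) «`sock_S9_productHaar_cm` payer» (R90-IF-plan (g2), R90 bus 2026-09-04T23:09:40Z, RULING νinf).
-/
import Summits.HodgeConjecture.HodgeConjecture.Theorems.F0P3Rung0HaarPackage              -- ★ p826197: `exists_isProductHaar` (the `ν := haar` edition, proof template); cone ★ `IsProductHaar`, ★ (C-glob) `exists_isHaarMeasure_arch_eq_map_prod_rpMeasure`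
import HarnessLib

/-!
# R90-TF · S9 «InnerForm-13.3.6 (c)» — FOR EVERY HAAR MEASURE `ν` ON `U(H)(𝔸)` AND EVERY NORMALISED LOCAL HAAR FAMILY THERE IS AN ARCHIMEDEAN HAAR MEASURE `ν_∞`
# WITH `IsProductHaar L H ν ν_∞ νG` — the payer of the ∃-socket `sock_S9_productHaar_cm` of B ED. 4 (RULING νinf, R90-IF-plan (g2) 23:09:40Z)

Cell `hodgecm-mathlib`, crux H413 (`stmt-HodgeConjecture-24833`, lane `--supports … --as helper`), route of record `HCCMUnconditional` (no route verbs; count-neutral).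
Programme R90-TF, section S9 = InnerForm-13.3.6 (c) (base `R90-IF`); seat R90-IF-p04 (g2).  DEALT BY NAME by R90-IF-plan (g2) 23:09:40Z ((e3), after the (e2) census):
«`sock_S9_productHaar_cm : ∀ ‹prefix›, ∃ νinf …, ‹Haar› ∧ F0P3LettersTraceFactorisation.IsProductHaar L H ν νinf νG` (payer E1 — Haar uniqueness …) — if
`∃ νinf, IsProductHaar L H ν νinf νG` is ≤ 80 lines … HEADS for ★ `Theorems/R90S9ArchProductHaarExists.lean`».  It is: the tree's PH-discharger ★
`F0P3Rung0HaarPackage.exists_isProductHaar` (p826197 §3) CHOOSES `ν := haar`, while the Literature (C-glob) theorem it rests on, ★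
`UnitaryGroup.exists_isHaarMeasure_arch_eq_map_prod_rpMeasure`, already quantifies over an ARBITRARY Haar measure `ν_𝔸` («for every Haar measure `ν_𝔸` on `U(H)(𝔸_{L⁺})`
and every local Haar family `(ν_v)` with `ν_v(U(H)(𝒪_v)) = 1` … there is a Haar measure `ν_∞` on `U(H)(L⁺ ⊗ ℝ)` with `ν_𝔸 = (adelicProdEquiv⁻¹)_* (ν_∞ ⊗ (finAdelicEquiv⁻¹)_*
∏′_v (ν_v ; U(H)(𝒪_v)))`»; the ★ `IsProductHaar` docstring names it as the in-house discharger).  This file re-runs the p826197 proof with the GIVEN `ν`.  THEOREMS ONLY: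
no `def`, no instance, no notation, no named fact, no `sorry`; namespace `Summit.HodgeConjecture.HodgeConjecture.R90.S9`.
HONEST LABEL: HC_CM is proved only modulo the 7 printed citations (2 remaining named inputs: hLiu418 = stmt-HodgeConjecture-24832, h413 = stmt-HodgeConjecture-24833) until rung 0
closes; in-house measure theory ([Rogawski1990, §5.4 p. 72] «`dg = ⊗ dg_v`, `vol(K_v) = 1` for almost all `v`»), no printed statement about automorphic forms is consumed.

## What is here (sorry-free, axioms ⊆ {propext, Classical.choice, Quot.sound})
* **`exists_archHaar_isProductHaar`** — for `ν` a Haar measure on `U(H)(𝔸_{L⁺})` (Borel σ-algebra), `νG` a family of Haar measures on the `U(H)(L⁺_v)` (Borel) with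
  `νG v (U(H)(𝒪_v)) = 1` for every `v`: `∃ νGi` (Borel, Haar on `U(H)(L⁺ ⊗ ℝ)`) with `IsProductHaar L H ν νGi νG`.  No anisotropy, no frame.
* **`exists_archHaar_isProductHaar_and`** — the same with `νGi.IsHaarMeasure` also exported as a separate conjunct (the socket's «‹its Haar … instances as conjuncts› ∧ …» shape).

[cite: Rogawski1990, §4.3 p. 44; §5.4 p. 72] [cite: CasselsFrohlichANT1967, Ch. XV (Tate) §3.3] [cite: BorelJacquet1979, §4.1]
-/

set_option autoImplicit false
set_option linter.dupNamespace false  -- the mandated namespace repeats the summit's segment (`HodgeConjecture.HodgeConjecture`)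

noncomputable section

namespace Summit.HodgeConjecture.HodgeConjecture.R90.S9

open MeasureTheory MeasureTheory.Measure NumberField IsDedekindDomain
open Literature.NumberTheory.Automorphic Literature.NumberTheory.Automorphic.UnitaryGroup
open Summit.HodgeConjecture.HodgeConjecture.Cruxes.H413.F0P3InnerFormClassificationV6 (Gp)
open Summit.HodgeConjecture.HodgeConjecture.Cruxes.H413.F0P3LettersTraceFactorisation (IsProductHaar)
open scoped Matrix

variable (L : Type) [Field L] [NumberField L] [IsCMField L] (H : Matrix (Fin 3) (Fin 3) L)

/-- **FOR EVERY HAAR `ν` ON `U(H)(𝔸_{L⁺})` AND EVERY NORMALISED LOCAL HAAR FAMILY `νG` THERE IS AN ARCHIMEDEAN HAAR `νGi` WITH `IsProductHaar L H ν νGi νG`** (Borel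
σ-algebras throughout, `letI := borel _` as in ★ `exists_isProductHaar`).  PROOF = ★ p826197 §3 with `haar` replaced by the given `ν`: the model family
`(localPiEquiv v)⁻¹_* νG_v` is Haar (★ `isHaarMeasure_map_localModel_symm`) of mass `1` on `localInt v` (★ `map_localPiEquiv_symm_apply_localInt_eq_one`), and (C-glob) ★
`exists_isHaarMeasure_arch_eq_map_prod_rpMeasure` supplies `νGi` with the product identity ON THE NOSE for the given `ν`. [cite: Rogawski1990, §5.4 p. 72; §4.3 p. 44]
[cite: CasselsFrohlichANT1967, Ch. XV (Tate) §3.3] [cite: BorelJacquet1979, §4.1] -/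
theorem exists_archHaar_isProductHaar
    (ν : @Measure (cmDatum L 3 H).Adelic (borel _)) (hν : letI : MeasurableSpace (cmDatum L 3 H).Adelic := borel _; ν.IsHaarMeasure)
    (νG : ∀ v : HeightOneSpectrum (𝓞 ↥(maximalRealSubfield L)), @Measure ((cmDatum L 3 H).Local v) (borel _))
    (hνG : ∀ v, letI : MeasurableSpace ((cmDatum L 3 H).Local v) := borel _; (νG v).IsHaarMeasure)
    (hK : ∀ v, νG v (cmLocalIntegralLevel L 3 H v : Set ((cmDatum L 3 H).Local v)) = 1) :
    ∃ νGi : @Measure ↥(UnitaryGroup.arch (↥(maximalRealSubfield L)) L (IsCMField.complexConj L) 3 H) (borel _),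
      (letI : MeasurableSpace (Gp L H).Adelic := borel _; IsProductHaar L H ν νGi νG) := by
  classical
  letI mA : MeasurableSpace (cmDatum L 3 H).Adelic := borel _
  haveI : BorelSpace (cmDatum L 3 H).Adelic := ⟨rfl⟩
  letI : MeasurableSpace ↥(UnitaryGroup.arch (↥(maximalRealSubfield L)) L (IsCMField.complexConj L) 3 H) := borel _
  haveI : BorelSpace ↥(UnitaryGroup.arch (↥(maximalRealSubfield L)) L (IsCMField.complexConj L) 3 H) := ⟨rfl⟩
  letI : ∀ v : HeightOneSpectrum (𝓞 ↥(maximalRealSubfield L)), MeasurableSpace ((cmDatum L 3 H).Local v) := fun _ => borel _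
  haveI : ∀ v : HeightOneSpectrum (𝓞 ↥(maximalRealSubfield L)), BorelSpace ((cmDatum L 3 H).Local v) := fun _ => ⟨rfl⟩
  letI : ∀ v : HeightOneSpectrum (𝓞 ↥(maximalRealSubfield L)),
      MeasurableSpace ↥(«local» L (IsCMField.complexConj L) 3 H v) := fun _ => borel _
  letI : ∀ v : HeightOneSpectrum (𝓞 ↥(maximalRealSubfield L)),
      MeasurableSpace ↥(localPi L (IsCMField.complexConj L) 3 H v) := fun _ => borel _
  haveI : ∀ v : HeightOneSpectrum (𝓞 ↥(maximalRealSubfield L)), BorelSpace ↥(localPi L (IsCMField.complexConj L) 3 H v) := fun _ => ⟨rfl⟩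
  letI : MeasurableSpace (finAdelic (↥(maximalRealSubfield L)) L (IsCMField.complexConj L) 3 H) := borel _
  haveI : BorelSpace (finAdelic (↥(maximalRealSubfield L)) L (IsCMField.complexConj L) 3 H) := ⟨rfl⟩
  haveI : ∀ v, (νG v).IsHaarMeasure := hνG
  haveI : ∀ v : HeightOneSpectrum (𝓞 ↥(maximalRealSubfield L)),
      IsHaarMeasure (Measure.map (localPiEquiv L (IsCMField.complexConj L) 3 H v).symm (νG v)) :=
    fun v => isHaarMeasure_map_localModel_symm v (localPiEquiv L (IsCMField.complexConj L) 3 H v) (νG v)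
  haveI hA : IsHaarMeasure ν := hν
  obtain ⟨νGi, hνGi, hPH⟩ := exists_isHaarMeasure_arch_eq_map_prod_rpMeasure
    (fun v => Measure.map (localPiEquiv L (IsCMField.complexConj L) 3 H v).symm (νG v)) ∅
    (fun v _ => map_localPiEquiv_symm_apply_localInt_eq_one v (localPiEquiv L (IsCMField.complexConj L) 3 H v) rfl (νG v) (hK v))
    ν _ rfl
  exact ⟨νGi, hA, hνGi, hνG, hK, hPH⟩

/-- **The socket shape** («`∃ νinf, ‹Haar› ∧ IsProductHaar L H ν νinf νG`»): the archimedean Haar fact exported beside PH. [cite: Rogawski1990, §5.4 p. 72; §4.3 p. 44]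
[cite: BorelJacquet1979, §4.1] -/
theorem exists_archHaar_isProductHaar_and
    (ν : @Measure (cmDatum L 3 H).Adelic (borel _)) (hν : letI : MeasurableSpace (cmDatum L 3 H).Adelic := borel _; ν.IsHaarMeasure)
    (νG : ∀ v : HeightOneSpectrum (𝓞 ↥(maximalRealSubfield L)), @Measure ((cmDatum L 3 H).Local v) (borel _))
    (hνG : ∀ v, letI : MeasurableSpace ((cmDatum L 3 H).Local v) := borel _; (νG v).IsHaarMeasure)
    (hK : ∀ v, νG v (cmLocalIntegralLevel L 3 H v : Set ((cmDatum L 3 H).Local v)) = 1) :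
    ∃ νGi : @Measure ↥(UnitaryGroup.arch (↥(maximalRealSubfield L)) L (IsCMField.complexConj L) 3 H) (borel _),
      (letI : MeasurableSpace ↥(UnitaryGroup.arch (↥(maximalRealSubfield L)) L (IsCMField.complexConj L) 3 H) := borel _; νGi.IsHaarMeasure) ∧
      (letI : MeasurableSpace (Gp L H).Adelic := borel _; IsProductHaar L H ν νGi νG) := by
  obtain ⟨νGi, hPH⟩ := exists_archHaar_isProductHaar L H ν hν νG hνG hK
  exact ⟨νGi, hPH.2.1, hPH⟩

end Summit.HodgeConjecture.HodgeConjecture.R90.S9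

end
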